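import Mathlib
import HarnessLib
import Literature.Analysis.FluidPDE.TypeIRateOseenMildRepresentative
import Literature.Analysis.FluidPDE.LocalTypeILiouville
import Literature.Analysis.FluidPDE.LocalTypeISlabProfile
import Summits.NavierStokesRegularity.NavierStokesRegularity.Theorems.SqueezeCycleExtremalElementExistsRegularity
import Summits.NavierStokesRegularity.NavierStokesRegularity.Theorems.SymmetryModuliCountForcedSymmetryRecurrentClosingSplit
import Summits.NavierStokesRegularity.NavierStokesRegularity.Theorems.SymmetryModuliCountForcedSymmetryStubSlabProfileOfNonzero
import Summits.NavierStokesRegularity.NavierStokesRegularity.Theorems.SymmetryModuliCountForcedSymmetryStubRdssClauseCongrAe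
import Summits.NavierStokesRegularity.NavierStokesRegularity.Theorems.SymmetryModuliCountForcedSymmetryStubBlowDownDriverStPull
import Summits.NavierStokesRegularity.NavierStokesRegularity.Theorems.SymmetryModuliCountForcedSymmetryRdssLiouvilleTauReduction

/-!
# Crux `ForcedSymmetry` (stmt-NavierStokesRegularity-4052), line `recurrent-closing`: the RESIDUAL after the bridge

Route `SymmetryModuliCount`, sub-problem `NavierStokesRegularity`.  Lead seat c3 (2026-08-17), skeleton
`Cruxes/ForcedSymmetry/Lines/recurrent_closing.lean` gen 4.

With the bridge `stub_slabProfileOfNonzero` LANDED (p139433) and the reduction to recurrent profiles `recurrentReduction_proof`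
(stmt-1590) in the tree, the line is closed MODULO its two research stubs and nothing else.  Gen 4 also discharges the
SMOOTHNESS demand of the closing stub: every profile of Albritton–Barker's slab class is a.e. an element of `A_C`
(`exists_oseenMild_repr_of_typeIBound_lt_top` + `isTypeIAncientMild_of_continuous_oseenMild`, KNSS Lemma 3.1 / Prop. 4.1),
which is classical with a pressure keeping it in the class (`slabProfile_of_isTypeIAncientMild`), and the RDSS clause and
the singular origin transfer along a.e. equality (`stub_rdssClause_congr_ae` p139220, `isBackwardSingularPoint_zero_of_ae_eq`).
So the research stub is `RecurrentClosingWeak` — the closing lemma of the scaling flow INSIDE the suitable-weak class —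
and

  `ForcedSymmetry ⇐ X ⇐ RecurrentClosingWeak ∧ RDSSLiouvilleInClass (stmt-8561)`  (`forcedSymmetry_of_recurrentClosingWeak`),

with stmt-8561 replaceable by its `τ = 0` core (`rdssLiouvilleInClass_iff_centreTimeZero`).

* `classicalRepresentative_of_rdssProfile` — RDSS singular profile of the class ⇒ a CLASSICAL one;
* `recurrentClosing_of_recurrentClosingWeak` — the gen-1 stub `stub_recurrentClosing` from the gen-4 stub;
* `typeIAncientLiouville_of_recurrentClosingWeak`, `forcedSymmetry_of_recurrentClosingWeak` (registered name),
  `forcedSymmetry_of_recurrentClosingWeak_centreTimeZero`;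
* `typeIAncientLiouville_of_not_localTypeISingularityExists`, `forcedSymmetry_of_not_localTypeISingularityExists` — by-product of
  the bridge alone: the crux follows from the NEGATION of Albritton–Barker's first bullet `LocalTypeISingularityExists` (the tree's
  registered OPEN statement "there exists a suitable weak solution with a Type I singular point"), via
  `localTypeISingularityExists_of_slabProfile`.

References: D. Albritton, T. Barker, J. Math. Fluid Mech. 21 (2019), Thm 1.1, Lemma 2.2, Prop. 2.3, §3 [AlbrittonBarker2019];
G. Koch, N. Nadirashvili, G. Seregin, V. Šverák, Acta Math. 203 (2009), Lemma 3.1, Prop. 4.1 [KochNadirashviliSereginSverak2009];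
T.-P. Tsai, *Lectures on Navier–Stokes equations* (2018), Conj. 8.8–8.9 [Tsai2018].
-/

noncomputable section

-- the summit and its single problem share the name (D-0017 nested layout)
set_option linter.dupNamespace false

open MeasureTheory Set Function Filter Metric
open scoped ENNReal NNReal
open Literature.Analysis.FluidPDE
open Summit.NavierStokesRegularity.NavierStokesRegularity.Theses.SymmetryModuliCount
open Summit.NavierStokesRegularity.NavierStokesRegularity.Theses.DulacContraction

namespace Summit.NavierStokesRegularity.NavierStokesRegularity.Theorems.SymmetryModuliCountForcedSymmetry

/-! ### The classical representative -/

/-- **The classical representative of an RDSS singular profile** (proved; the gen-4 glue of the skeleton): a profile of Albritton–Barker's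
class (suitable weak on the slab, `𝐈 < ∞`, Type-I rate `C'`) which is RDSS-invariant a.e. and singular at the origin may
be replaced by one that is, in addition, CLASSICAL on `(−∞,0)`: its continuous Oseen-mild representative `v ∈ A_{C'}`
(`exists_oseenMild_repr_of_typeIBound_lt_top` + `isTypeIAncientMild_of_continuous_oseenMild`, KNSS Lemma 3.1 / Prop 4.1)
carries a classical pressure keeping it in the class (`slabProfile_of_isTypeIAncientMild`, the bridge file), the RDSS
clause transfers along the a.e. equality (`stub_rdssClause_congr_ae`, p139220) and so does the singular origin
(`isBackwardSingularPoint_zero_of_ae_eq`). [cite: KochNadirashviliSereginSverak2009, Lemma 3.1, Prop. 4.1; AlbrittonBarker2019, §3] -/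
theorem classicalRepresentative_of_rdssProfile
    {w : ℝ → EuclideanSpace ℝ (Fin 3) → EuclideanSpace ℝ (Fin 3)} {q : ℝ → EuclideanSpace ℝ (Fin 3) → ℝ}
    {H : ℝ → EuclideanSpace ℝ (Fin 3) → EuclideanSpace ℝ (Fin 3) →L[ℝ] EuclideanSpace ℝ (Fin 3)} {C' : ℝ}
    (hsw : IsSuitableWeakSolutionOn (slab (EuclideanSpace ℝ (Fin 3)) (Set.Iio 0) isOpen_Iio) 1 0 w q)
    (hI : typeIBound (Set.Iio (0 : ℝ) ×ˢ Set.univ) w q H < ⊤) (hdec : HasTypeITimeDecay C' w)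
    (hrdss : ∃ l : ℝ, 1 < l ∧ ∃ (R : EuclideanSpace ℝ (Fin 3) ≃ₗᵢ[ℝ] EuclideanSpace ℝ (Fin 3))
        (ξ : EuclideanSpace ℝ (Fin 3)) (τ : ℝ), τ ≤ 0 ∧
        (fun z : ℝ × EuclideanSpace ℝ (Fin 3) => l • R.symm (w (l ^ 2 * z.1 + τ) (l • R z.2 + ξ)))
          =ᵐ[volume.restrict (Set.Iio (0 : ℝ) ×ˢ Set.univ)]
        (fun z : ℝ × EuclideanSpace ℝ (Fin 3) => w z.1 z.2))
    (hsing : IsBackwardSingularPoint w 0) :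
    ∃ (w' : ℝ → EuclideanSpace ℝ (Fin 3) → EuclideanSpace ℝ (Fin 3)) (q' : ℝ → EuclideanSpace ℝ (Fin 3) → ℝ)
      (H' : ℝ → EuclideanSpace ℝ (Fin 3) → EuclideanSpace ℝ (Fin 3) →L[ℝ] EuclideanSpace ℝ (Fin 3)) (C'' : ℝ),
      IsSuitableWeakSolutionOn (slab (EuclideanSpace ℝ (Fin 3)) (Set.Iio 0) isOpen_Iio) 1 0 w' q' ∧
      HasWeakSpatialGradientOn (slab (EuclideanSpace ℝ (Fin 3)) (Set.Iio 0) isOpen_Iio) w' H' ∧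
      typeIBound (Set.Iio (0 : ℝ) ×ˢ Set.univ) w' q' H' < ⊤ ∧
      HasTypeITimeDecay C'' w' ∧
      IsClassicalNSSolutionOn (Set.Iio 0) 1 0 w' q' ∧
      (∃ l : ℝ, 1 < l ∧ ∃ (R : EuclideanSpace ℝ (Fin 3) ≃ₗᵢ[ℝ] EuclideanSpace ℝ (Fin 3))
          (ξ : EuclideanSpace ℝ (Fin 3)) (τ : ℝ), τ ≤ 0 ∧
          (fun z : ℝ × EuclideanSpace ℝ (Fin 3) => l • R.symm (w' (l ^ 2 * z.1 + τ) (l • R z.2 + ξ)))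
            =ᵐ[volume.restrict (Set.Iio (0 : ℝ) ×ˢ Set.univ)]
          (fun z : ℝ × EuclideanSpace ℝ (Fin 3) => w' z.1 z.2)) ∧
      IsBackwardSingularPoint w' 0 := by
  -- the continuous Oseen-mild representative `v ∈ A_{C'}`
  obtain ⟨v, hae, hvc, hvd, hvm, hvC⟩ := exists_oseenMild_repr_of_typeIBound_lt_top hsw hdec hI
  have hv : IsTypeIAncientMild C' v :=
    Summit.NavierStokesRegularity.NavierStokesRegularity.Theorems.isTypeIAncientMild_of_continuous_oseenMild hvc hvd hvm hvC
  -- `v` is a classical slab profile of the class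
  obtain ⟨p, hp, hswv, hwgv, hIv⟩ :=
    slabProfile_of_isTypeIAncientMild hv
  have hae' : Function.uncurry w =ᵐ[volume.restrict (Set.Iio (0 : ℝ) ×ˢ Set.univ)] Function.uncurry v := hae
  refine ⟨v, p, fun t x => fderiv ℝ (v t) x, C', hswv, hwgv, hIv, hv.hasTypeITimeDecay, hp, ?_, ?_⟩
  · exact stub_rdssClause_congr_ae
      w v hae' hrdss
  · have hsub : parabolicCylinder 1 (0 : ℝ × EuclideanSpace ℝ (Fin 3)) ⊆
        Set.Iio (0 : ℝ) ×ˢ (Set.univ : Set (EuclideanSpace ℝ (Fin 3))) :=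
      parabolicCylinder_origin_subset_slab 1
    exact isBackwardSingularPoint_zero_of_ae_eq
      one_pos hsing (ae_restrict_of_ae_restrict_of_subset hsub hae')


/-! ### The gen-1 closing stub from the gen-4 one -/

/-- **`RecurrentClosingWeak → RecurrentClosing`**: the gen-1 registered stub `stub_recurrentClosing` (conclusion with
`IsClassicalNSSolutionOn`) follows from the gen-4 stub `stub_recurrentClosingWeak` (conclusion in the suitable-weak class) by
`classicalRepresentative_of_rdssProfile`. [cite: KochNadirashviliSereginSverak2009, Lemma 3.1, Prop. 4.1] -/
theorem recurrentClosing_of_recurrentClosingWeak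
    (h₂ : ∀ (u : ℝ → EuclideanSpace ℝ (Fin 3) → EuclideanSpace ℝ (Fin 3)) (p : ℝ → EuclideanSpace ℝ (Fin 3) → ℝ)
        (G : ℝ → EuclideanSpace ℝ (Fin 3) → EuclideanSpace ℝ (Fin 3) →L[ℝ] EuclideanSpace ℝ (Fin 3)) (C : ℝ),
        IsSuitableWeakSolutionOn (slab (EuclideanSpace ℝ (Fin 3)) (Set.Iio 0) isOpen_Iio) 1 0 u p →
        HasWeakSpatialGradientOn (slab (EuclideanSpace ℝ (Fin 3)) (Set.Iio 0) isOpen_Iio) u G →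
        typeIBound (Set.Iio (0 : ℝ) ×ˢ Set.univ) u p G < ⊤ →
        HasTypeITimeDecay C u →
        (∀ ε : ℝ, 0 < ε → ∀ K : Set (ℝ × EuclideanSpace ℝ (Fin 3)), IsCompact K → K ⊆ Set.Iic (0 : ℝ) ×ˢ Set.univ →
          ∃ L : ℝ, 0 < L ∧ ∀ a : ℝ, ∃ σ ∈ Set.Icc a (a + L),
            eLpNorm (fun z : ℝ × EuclideanSpace ℝ (Fin 3) => nsRescale (Real.exp σ) u z.1 z.2 - u z.1 z.2) 3
              (volume.restrict K) ≤ ENNReal.ofReal ε) →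
        IsBackwardSingularPoint u 0 →
        ∃ (w : ℝ → EuclideanSpace ℝ (Fin 3) → EuclideanSpace ℝ (Fin 3)) (q : ℝ → EuclideanSpace ℝ (Fin 3) → ℝ)
          (H : ℝ → EuclideanSpace ℝ (Fin 3) → EuclideanSpace ℝ (Fin 3) →L[ℝ] EuclideanSpace ℝ (Fin 3)) (C' : ℝ),
          IsSuitableWeakSolutionOn (slab (EuclideanSpace ℝ (Fin 3)) (Set.Iio 0) isOpen_Iio) 1 0 w q ∧
          HasWeakSpatialGradientOn (slab (EuclideanSpace ℝ (Fin 3)) (Set.Iio 0) isOpen_Iio) w H ∧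
          typeIBound (Set.Iio (0 : ℝ) ×ˢ Set.univ) w q H < ⊤ ∧
          HasTypeITimeDecay C' w ∧
          (∃ l : ℝ, 1 < l ∧ ∃ (R : EuclideanSpace ℝ (Fin 3) ≃ₗᵢ[ℝ] EuclideanSpace ℝ (Fin 3))
              (ξ : EuclideanSpace ℝ (Fin 3)) (τ : ℝ), τ ≤ 0 ∧
              (fun z : ℝ × EuclideanSpace ℝ (Fin 3) => l • R.symm (w (l ^ 2 * z.1 + τ) (l • R z.2 + ξ)))
                =ᵐ[volume.restrict (Set.Iio (0 : ℝ) ×ˢ Set.univ)]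
              (fun z : ℝ × EuclideanSpace ℝ (Fin 3) => w z.1 z.2)) ∧
          IsBackwardSingularPoint w 0)
    :
    ∀ (u : ℝ → EuclideanSpace ℝ (Fin 3) → EuclideanSpace ℝ (Fin 3)) (p : ℝ → EuclideanSpace ℝ (Fin 3) → ℝ)
      (G : ℝ → EuclideanSpace ℝ (Fin 3) → EuclideanSpace ℝ (Fin 3) →L[ℝ] EuclideanSpace ℝ (Fin 3)) (C : ℝ),
      Literature.Analysis.FluidPDE.IsSuitableWeakSolutionOn
          (Literature.Analysis.FluidPDE.slab (EuclideanSpace ℝ (Fin 3)) (Set.Iio 0) isOpen_Iio) 1 0 u p →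
      Literature.Analysis.FluidPDE.HasWeakSpatialGradientOn
          (Literature.Analysis.FluidPDE.slab (EuclideanSpace ℝ (Fin 3)) (Set.Iio 0) isOpen_Iio) u G →
      Literature.Analysis.FluidPDE.typeIBound (Set.Iio (0 : ℝ) ×ˢ Set.univ) u p G < ⊤ →
      Literature.Analysis.FluidPDE.HasTypeITimeDecay C u →
      (∀ ε : ℝ, 0 < ε → ∀ K : Set (ℝ × EuclideanSpace ℝ (Fin 3)), IsCompact K → K ⊆ Set.Iic (0 : ℝ) ×ˢ Set.univ →
        ∃ L : ℝ, 0 < L ∧ ∀ a : ℝ, ∃ σ ∈ Set.Icc a (a + L),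
          MeasureTheory.eLpNorm (fun z : ℝ × EuclideanSpace ℝ (Fin 3) =>
            Literature.Analysis.FluidPDE.nsRescale (Real.exp σ) u z.1 z.2 - u z.1 z.2) 3
            (MeasureTheory.volume.restrict K) ≤ ENNReal.ofReal ε) →
      Literature.Analysis.FluidPDE.IsBackwardSingularPoint u 0 →
      ∃ (w : ℝ → EuclideanSpace ℝ (Fin 3) → EuclideanSpace ℝ (Fin 3)) (q : ℝ → EuclideanSpace ℝ (Fin 3) → ℝ)
        (H : ℝ → EuclideanSpace ℝ (Fin 3) → EuclideanSpace ℝ (Fin 3) →L[ℝ] EuclideanSpace ℝ (Fin 3)) (C' : ℝ),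
        Literature.Analysis.FluidPDE.IsSuitableWeakSolutionOn
            (Literature.Analysis.FluidPDE.slab (EuclideanSpace ℝ (Fin 3)) (Set.Iio 0) isOpen_Iio) 1 0 w q ∧
        Literature.Analysis.FluidPDE.HasWeakSpatialGradientOn
            (Literature.Analysis.FluidPDE.slab (EuclideanSpace ℝ (Fin 3)) (Set.Iio 0) isOpen_Iio) w H ∧
        Literature.Analysis.FluidPDE.typeIBound (Set.Iio (0 : ℝ) ×ˢ Set.univ) w q H < ⊤ ∧
        Literature.Analysis.FluidPDE.HasTypeITimeDecay C' w ∧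
        Literature.Analysis.FluidPDE.IsClassicalNSSolutionOn (Set.Iio 0) 1 0 w q ∧
        (∃ l : ℝ, 1 < l ∧ ∃ (R : EuclideanSpace ℝ (Fin 3) ≃ₗᵢ[ℝ] EuclideanSpace ℝ (Fin 3))
            (ξ : EuclideanSpace ℝ (Fin 3)) (τ : ℝ), τ ≤ 0 ∧
            (fun z : ℝ × EuclideanSpace ℝ (Fin 3) => l • R.symm (w (l ^ 2 * z.1 + τ) (l • R z.2 + ξ)))
              =ᵐ[MeasureTheory.volume.restrict (Set.Iio (0 : ℝ) ×ˢ Set.univ)]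
            (fun z : ℝ × EuclideanSpace ℝ (Fin 3) => w z.1 z.2)) ∧
        Literature.Analysis.FluidPDE.IsBackwardSingularPoint w 0 := by
  intro u p G C hsw hwg hI hdec hrec hsing
  obtain ⟨w, q, H, C', hw, -, hIw, hCw, hrdss, hsingw⟩ := h₂ u p G C hsw hwg hI hdec hrec hsing
  obtain ⟨w', q', H', C'', h1, h2, h3, h4, h5, h6, h7⟩ := classicalRepresentative_of_rdssProfile hw hIw hCw hrdss hsingw
  exact ⟨w', q', H', C'', h1, h2, h3, h4, h5, h6, h7⟩

/-! ### The crux from the two research stubs (bridge discharged) -/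

/-- **`X` from the two research pieces of the line** (bridge discharged): `RecurrentClosingWeak → RDSSLiouvilleInClass →
TypeIAncientLiouville`. [cite: AlbrittonBarker2019, Thm 1.1 (the class); census §D5] -/
theorem typeIAncientLiouville_of_recurrentClosingWeak
    (h₂ : ∀ (u : ℝ → EuclideanSpace ℝ (Fin 3) → EuclideanSpace ℝ (Fin 3)) (p : ℝ → EuclideanSpace ℝ (Fin 3) → ℝ)
        (G : ℝ → EuclideanSpace ℝ (Fin 3) → EuclideanSpace ℝ (Fin 3) →L[ℝ] EuclideanSpace ℝ (Fin 3)) (C : ℝ),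
        IsSuitableWeakSolutionOn (slab (EuclideanSpace ℝ (Fin 3)) (Set.Iio 0) isOpen_Iio) 1 0 u p →
        HasWeakSpatialGradientOn (slab (EuclideanSpace ℝ (Fin 3)) (Set.Iio 0) isOpen_Iio) u G →
        typeIBound (Set.Iio (0 : ℝ) ×ˢ Set.univ) u p G < ⊤ →
        HasTypeITimeDecay C u →
        (∀ ε : ℝ, 0 < ε → ∀ K : Set (ℝ × EuclideanSpace ℝ (Fin 3)), IsCompact K → K ⊆ Set.Iic (0 : ℝ) ×ˢ Set.univ →
          ∃ L : ℝ, 0 < L ∧ ∀ a : ℝ, ∃ σ ∈ Set.Icc a (a + L),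
            eLpNorm (fun z : ℝ × EuclideanSpace ℝ (Fin 3) => nsRescale (Real.exp σ) u z.1 z.2 - u z.1 z.2) 3
              (volume.restrict K) ≤ ENNReal.ofReal ε) →
        IsBackwardSingularPoint u 0 →
        ∃ (w : ℝ → EuclideanSpace ℝ (Fin 3) → EuclideanSpace ℝ (Fin 3)) (q : ℝ → EuclideanSpace ℝ (Fin 3) → ℝ)
          (H : ℝ → EuclideanSpace ℝ (Fin 3) → EuclideanSpace ℝ (Fin 3) →L[ℝ] EuclideanSpace ℝ (Fin 3)) (C' : ℝ),
          IsSuitableWeakSolutionOn (slab (EuclideanSpace ℝ (Fin 3)) (Set.Iio 0) isOpen_Iio) 1 0 w q ∧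
          HasWeakSpatialGradientOn (slab (EuclideanSpace ℝ (Fin 3)) (Set.Iio 0) isOpen_Iio) w H ∧
          typeIBound (Set.Iio (0 : ℝ) ×ˢ Set.univ) w q H < ⊤ ∧
          HasTypeITimeDecay C' w ∧
          (∃ l : ℝ, 1 < l ∧ ∃ (R : EuclideanSpace ℝ (Fin 3) ≃ₗᵢ[ℝ] EuclideanSpace ℝ (Fin 3))
              (ξ : EuclideanSpace ℝ (Fin 3)) (τ : ℝ), τ ≤ 0 ∧
              (fun z : ℝ × EuclideanSpace ℝ (Fin 3) => l • R.symm (w (l ^ 2 * z.1 + τ) (l • R z.2 + ξ)))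
                =ᵐ[volume.restrict (Set.Iio (0 : ℝ) ×ˢ Set.univ)]
              (fun z : ℝ × EuclideanSpace ℝ (Fin 3) => w z.1 z.2)) ∧
          IsBackwardSingularPoint w 0)
    (h₃ : RDSSLiouvilleInClass) : TypeIAncientLiouville :=
  RecurrentClosingSplit.typeIAncientLiouville_of_recurrentClosing_subs stub_slabProfileOfNonzero
    (recurrentClosing_of_recurrentClosingWeak h₂) h₃

/-- **The crux from the two research pieces of the line** (bridge discharged; REGISTERED NAME): `RecurrentClosingWeak →
RDSSLiouvilleInClass → ForcedSymmetry`.  After this file the registered skeleton of the line has exactly two open stubs,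
`stub_recurrentClosingWeak` (no item yet; census R6 proposes one) and `stub_rdssLiouville` = stmt-8561.
[cite: AlbrittonBarker2019, Thm 1.1; census §D5/R6] -/
theorem forcedSymmetry_of_recurrentClosingWeak
    (h₂ : ∀ (u : ℝ → EuclideanSpace ℝ (Fin 3) → EuclideanSpace ℝ (Fin 3)) (p : ℝ → EuclideanSpace ℝ (Fin 3) → ℝ)
        (G : ℝ → EuclideanSpace ℝ (Fin 3) → EuclideanSpace ℝ (Fin 3) →L[ℝ] EuclideanSpace ℝ (Fin 3)) (C : ℝ),
        IsSuitableWeakSolutionOn (slab (EuclideanSpace ℝ (Fin 3)) (Set.Iio 0) isOpen_Iio) 1 0 u p →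
        HasWeakSpatialGradientOn (slab (EuclideanSpace ℝ (Fin 3)) (Set.Iio 0) isOpen_Iio) u G →
        typeIBound (Set.Iio (0 : ℝ) ×ˢ Set.univ) u p G < ⊤ →
        HasTypeITimeDecay C u →
        (∀ ε : ℝ, 0 < ε → ∀ K : Set (ℝ × EuclideanSpace ℝ (Fin 3)), IsCompact K → K ⊆ Set.Iic (0 : ℝ) ×ˢ Set.univ →
          ∃ L : ℝ, 0 < L ∧ ∀ a : ℝ, ∃ σ ∈ Set.Icc a (a + L),
            eLpNorm (fun z : ℝ × EuclideanSpace ℝ (Fin 3) => nsRescale (Real.exp σ) u z.1 z.2 - u z.1 z.2) 3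
              (volume.restrict K) ≤ ENNReal.ofReal ε) →
        IsBackwardSingularPoint u 0 →
        ∃ (w : ℝ → EuclideanSpace ℝ (Fin 3) → EuclideanSpace ℝ (Fin 3)) (q : ℝ → EuclideanSpace ℝ (Fin 3) → ℝ)
          (H : ℝ → EuclideanSpace ℝ (Fin 3) → EuclideanSpace ℝ (Fin 3) →L[ℝ] EuclideanSpace ℝ (Fin 3)) (C' : ℝ),
          IsSuitableWeakSolutionOn (slab (EuclideanSpace ℝ (Fin 3)) (Set.Iio 0) isOpen_Iio) 1 0 w q ∧
          HasWeakSpatialGradientOn (slab (EuclideanSpace ℝ (Fin 3)) (Set.Iio 0) isOpen_Iio) w H ∧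
          typeIBound (Set.Iio (0 : ℝ) ×ˢ Set.univ) w q H < ⊤ ∧
          HasTypeITimeDecay C' w ∧
          (∃ l : ℝ, 1 < l ∧ ∃ (R : EuclideanSpace ℝ (Fin 3) ≃ₗᵢ[ℝ] EuclideanSpace ℝ (Fin 3))
              (ξ : EuclideanSpace ℝ (Fin 3)) (τ : ℝ), τ ≤ 0 ∧
              (fun z : ℝ × EuclideanSpace ℝ (Fin 3) => l • R.symm (w (l ^ 2 * z.1 + τ) (l • R z.2 + ξ)))
                =ᵐ[volume.restrict (Set.Iio (0 : ℝ) ×ˢ Set.univ)]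
              (fun z : ℝ × EuclideanSpace ℝ (Fin 3) => w z.1 z.2)) ∧
          IsBackwardSingularPoint w 0)
    (h₃ : RDSSLiouvilleInClass) : ForcedSymmetry :=
  forcedSymmetry_of_typeIAncientLiouville (typeIAncientLiouville_of_recurrentClosingWeak h₂ h₃)

/-- **The crux from `RecurrentClosingWeak` and the `τ = 0` core of stmt-8561** (the `τ < 0` case of `RDSSLiouvilleInClass`
being elementary, `rdssLiouvilleInClass_iff_centreTimeZero`). [cite: Tsai2018, Conj. 8.8–8.9] -/
theorem forcedSymmetry_of_recurrentClosingWeak_centreTimeZero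
    (h₂ : ∀ (u : ℝ → EuclideanSpace ℝ (Fin 3) → EuclideanSpace ℝ (Fin 3)) (p : ℝ → EuclideanSpace ℝ (Fin 3) → ℝ)
        (G : ℝ → EuclideanSpace ℝ (Fin 3) → EuclideanSpace ℝ (Fin 3) →L[ℝ] EuclideanSpace ℝ (Fin 3)) (C : ℝ),
        IsSuitableWeakSolutionOn (slab (EuclideanSpace ℝ (Fin 3)) (Set.Iio 0) isOpen_Iio) 1 0 u p →
        HasWeakSpatialGradientOn (slab (EuclideanSpace ℝ (Fin 3)) (Set.Iio 0) isOpen_Iio) u G →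
        typeIBound (Set.Iio (0 : ℝ) ×ˢ Set.univ) u p G < ⊤ →
        HasTypeITimeDecay C u →
        (∀ ε : ℝ, 0 < ε → ∀ K : Set (ℝ × EuclideanSpace ℝ (Fin 3)), IsCompact K → K ⊆ Set.Iic (0 : ℝ) ×ˢ Set.univ →
          ∃ L : ℝ, 0 < L ∧ ∀ a : ℝ, ∃ σ ∈ Set.Icc a (a + L),
            eLpNorm (fun z : ℝ × EuclideanSpace ℝ (Fin 3) => nsRescale (Real.exp σ) u z.1 z.2 - u z.1 z.2) 3
              (volume.restrict K) ≤ ENNReal.ofReal ε) →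
        IsBackwardSingularPoint u 0 →
        ∃ (w : ℝ → EuclideanSpace ℝ (Fin 3) → EuclideanSpace ℝ (Fin 3)) (q : ℝ → EuclideanSpace ℝ (Fin 3) → ℝ)
          (H : ℝ → EuclideanSpace ℝ (Fin 3) → EuclideanSpace ℝ (Fin 3) →L[ℝ] EuclideanSpace ℝ (Fin 3)) (C' : ℝ),
          IsSuitableWeakSolutionOn (slab (EuclideanSpace ℝ (Fin 3)) (Set.Iio 0) isOpen_Iio) 1 0 w q ∧
          HasWeakSpatialGradientOn (slab (EuclideanSpace ℝ (Fin 3)) (Set.Iio 0) isOpen_Iio) w H ∧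
          typeIBound (Set.Iio (0 : ℝ) ×ˢ Set.univ) w q H < ⊤ ∧
          HasTypeITimeDecay C' w ∧
          (∃ l : ℝ, 1 < l ∧ ∃ (R : EuclideanSpace ℝ (Fin 3) ≃ₗᵢ[ℝ] EuclideanSpace ℝ (Fin 3))
              (ξ : EuclideanSpace ℝ (Fin 3)) (τ : ℝ), τ ≤ 0 ∧
              (fun z : ℝ × EuclideanSpace ℝ (Fin 3) => l • R.symm (w (l ^ 2 * z.1 + τ) (l • R z.2 + ξ)))
                =ᵐ[volume.restrict (Set.Iio (0 : ℝ) ×ˢ Set.univ)]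
              (fun z : ℝ × EuclideanSpace ℝ (Fin 3) => w z.1 z.2)) ∧
          IsBackwardSingularPoint w 0)
    (h₃ : ∀ (w : ℝ → EuclideanSpace ℝ (Fin 3) → EuclideanSpace ℝ (Fin 3)) (q : ℝ → EuclideanSpace ℝ (Fin 3) → ℝ)
        (H : ℝ → EuclideanSpace ℝ (Fin 3) → EuclideanSpace ℝ (Fin 3) →L[ℝ] EuclideanSpace ℝ (Fin 3)) (C : ℝ),
        IsSuitableWeakSolutionOn (slab (EuclideanSpace ℝ (Fin 3)) (Set.Iio 0) isOpen_Iio) 1 0 w q →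
        HasWeakSpatialGradientOn (slab (EuclideanSpace ℝ (Fin 3)) (Set.Iio 0) isOpen_Iio) w H →
        typeIBound (Set.Iio (0 : ℝ) ×ˢ Set.univ) w q H < ⊤ →
        HasTypeITimeDecay C w →
        IsClassicalNSSolutionOn (Set.Iio 0) 1 0 w q →
        (∃ l : ℝ, 1 < l ∧ ∃ (R : EuclideanSpace ℝ (Fin 3) ≃ₗᵢ[ℝ] EuclideanSpace ℝ (Fin 3)) (ξ : EuclideanSpace ℝ (Fin 3)),
          (fun z : ℝ × EuclideanSpace ℝ (Fin 3) => l • R.symm (w (l ^ 2 * z.1) (l • R z.2 + ξ)))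
            =ᵐ[volume.restrict (Set.Iio (0 : ℝ) ×ˢ Set.univ)]
          (fun z : ℝ × EuclideanSpace ℝ (Fin 3) => w z.1 z.2)) →
        ¬ IsBackwardSingularPoint w 0) : ForcedSymmetry :=
  forcedSymmetry_of_recurrentClosingWeak h₂ (rdssLiouvilleInClass_iff_centreTimeZero.2 h₃)

/-! ### By-product of the bridge: the crux follows from the negation of Albritton–Barker's first bullet -/

/-- **`¬ LocalTypeISingularityExists → X`.**  If no suitable weak solution of Navier–Stokes has a Type I singular point in
the sense of Albritton–Barker 2019 (Thm 1.1, first bullet; the tree's registered open statement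
`LocalTypeISingularityExists`), then every Type-I ancient KNSS-mild solution vanishes: a nonzero one would give, by the bridge
`stub_slabProfileOfNonzero`, a singular slab profile with `𝐈 < ∞`, which IS a local Type I singular point
(`localTypeISingularityExists_of_slabProfile`). [cite: AlbrittonBarker2019, Thm 1.1 (first bullet) and §3] -/
theorem typeIAncientLiouville_of_not_localTypeISingularityExists (h : ¬ LocalTypeISingularityExists) :
    TypeIAncientLiouville := by
  intro C u hu t ht x
  by_contra hx
  have hu' : IsTypeIAncientMild C u := isTypeIAncientMild_iff.2 hu
  obtain ⟨w, q, G, C', hsw, hwg, hI, -, hsing⟩ := stub_slabProfileOfNonzero C u hu' ⟨t, ht, x, hx⟩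
  exact h (localTypeISingularityExists_of_slabProfile hsw hwg hI hsing)

/-- **`¬ LocalTypeISingularityExists → ForcedSymmetry`**: the crux of route `SymmetryModuliCount` follows from the negation of
Albritton–Barker's first bullet, by `typeIAncientLiouville_of_not_localTypeISingularityExists` and the collapse
`forcedSymmetry_of_typeIAncientLiouville`. [cite: AlbrittonBarker2019, Thm 1.1 (first bullet)] -/
theorem forcedSymmetry_of_not_localTypeISingularityExists (h : ¬ LocalTypeISingularityExists) : ForcedSymmetry :=
  forcedSymmetry_of_typeIAncientLiouville (typeIAncientLiouville_of_not_localTypeISingularityExists h)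

end Summit.NavierStokesRegularity.NavierStokesRegularity.Theorems.SymmetryModuliCountForcedSymmetry

end
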